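import Literature.NumberTheory.Sieve.AffineLatticeParametrisationComplexity
import Mathlib.LinearAlgebra.Matrix.NonsingularInverse
import HarnessLib

/-!
# Real extension of the parametrisation of `{Ax = b}`: a bounded left inverse (Green–Tao 2010, §4, derivation of Theorem 1.8) — module M1d of rung F-CS1-eq

Topic `Literature/NumberTheory/Sieve`. Source: B. Green, T. Tao, *Linear equations in primes*,
Ann. of Math. 171 (2010), §4 (arXiv:math/0606088 p. 11): "`∑_{n ∈ ℤ^{t−s} ∩ K'} ∏ Λ(ψᵢ(n))`
where `K' ⊆ [−N', N']^{t−s}` for some `N' = O_{s,t,L}(N)`" — the preimage `K' = Ψ_ℝ⁻¹(K)` of a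
body `K ⊆ [−N, N]^t` under the real extension of the (injective) parametrisation is contained in
a box of comparable size. The unstated linear algebra: the generator matrix `M = genMat A` has
independent columns, so its Gram matrix `MᵀM` is invertible and `R = (MᵀM)⁻¹Mᵀ` is a rational
left inverse, `RM = 1`; hence `|cⱼ| ≤ ‖R‖₁ · maxᵢ |(Mc)ᵢ|` over `ℝ`.

Contents: `realEval_paramSystem`, `realEval_paramSystem_realPoint` (the real extension of
`paramSystem A x₀` and its values at lattice points), `gramMat`, `isUnit_gramMat`, `leftInv`,
`leftInv_mul_genMat` (`RM = 1` over `ℚ`), `realLeftInv_mul_realGenMat` (over `ℝ`),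
**`exists_coord_bound`** (`|cⱼ| ≤ C'(A) T` whenever `|(Mc)ᵢ| ≤ T` for all `i`) and
**`exists_preimage_box_bound`** (`Ψ_ℝ(c) ∈ [−N, N]^t ⇒ |cⱼ| ≤ C'(A)(N + maxᵢ|x₀ᵢ|)`).

## References

* [GreenTao2010] B. Green, T. Tao, *Linear equations in primes*, Ann. of Math. (2) 171 (2010),
  §4 (derivation of Thm. 1.8).
-/

noncomputable section

open Finset Module
open scoped Matrix

namespace Literature.NumberTheory.Sieve

variable {s t : ℕ}

/-! ### The real extension of the parametrising system -/

/-- `Ψ_ℝ(c)ᵢ = ∑ⱼ (vⱼ)ᵢ cⱼ + (x₀)ᵢ`. [cite: GreenTao2010, §4 (derivation of Thm. 1.8) and Def. 1.1] -/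
theorem realEval_paramSystem (A : Matrix (Fin s) (Fin t) ℤ) (x₀ : Fin t → ℤ)
    (c : Fin (kerDim A) → ℝ) (i : Fin t) :
    (paramSystem A x₀ i).realEval c = ∑ j, (kerGen A j i : ℝ) * c j + (x₀ i : ℝ) := rfl

/-- At lattice points the real extension is the parametrisation: `Ψ_ℝ(c) = Ψ(c)` for `c ∈ ℤ^n`.
[cite: GreenTao2010, §4 (derivation of Thm. 1.8) and Def. 1.1] -/
theorem realEval_paramSystem_realPoint (A : Matrix (Fin s) (Fin t) ℤ) (x₀ : Fin t → ℤ)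
    (c : Fin (kerDim A) → ℤ) (i : Fin t) :
    (paramSystem A x₀ i).realEval (realPoint c) = ((paramPoint A x₀ c i : ℤ) : ℝ) := by
  rw [← eval_paramSystem]
  simp only [AffLinForm.realEval, AffLinForm.eval, realPoint, paramSystem_coeff, paramSystem_const]
  push_cast
  rfl

/-- `realPoint (Ψ c) = Ψ_ℝ (realPoint c)` as vectors. [cite: GreenTao2010, §4 (derivation of Thm. 1.8)] -/
theorem realPoint_paramPoint (A : Matrix (Fin s) (Fin t) ℤ) (x₀ : Fin t → ℤ)
    (c : Fin (kerDim A) → ℤ) :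
    realPoint (paramPoint A x₀ c) = fun i => (paramSystem A x₀ i).realEval (realPoint c) := by
  funext i
  rw [realEval_paramSystem_realPoint]
  rfl

/-! ### The Gram matrix and a rational left inverse of the generator matrix -/

/-- The generator matrix is injective (independent columns).
[cite: GreenTao2010, §4 (derivation of Thm. 1.8)] -/
theorem mulVec_genMat_injective (A : Matrix (Fin s) (Fin t) ℤ) :
    Function.Injective (genMat A).mulVec :=
  Matrix.mulVec_injective_iff.mpr (linearIndependent_castVec_kerGen A)

/-- The Gram matrix `MᵀM` of the generators. [cite: GreenTao2010, §4 (derivation of Thm. 1.8)] -/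
def gramMat (A : Matrix (Fin s) (Fin t) ℤ) : Matrix (Fin (kerDim A)) (Fin (kerDim A)) ℚ :=
  (genMat A)ᵀ * genMat A

/-- `c ⬝ (MᵀM c) = |Mc|²`. [cite: GreenTao2010, §4 (derivation of Thm. 1.8)] -/
theorem dotProduct_gramMat_mulVec (A : Matrix (Fin s) (Fin t) ℤ) (v : Fin (kerDim A) → ℚ) :
    v ⬝ᵥ (gramMat A *ᵥ v) = (genMat A *ᵥ v) ⬝ᵥ (genMat A *ᵥ v) := by
  rw [gramMat, ← Matrix.mulVec_mulVec, Matrix.dotProduct_mulVec, Matrix.vecMul_transpose]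

/-- **The Gram matrix is invertible** (positive definite on `ℚ^n`).
[cite: GreenTao2010, §4 (derivation of Thm. 1.8)] -/
theorem isUnit_gramMat (A : Matrix (Fin s) (Fin t) ℤ) : IsUnit (gramMat A) := by
  refine Matrix.mulVec_injective_iff_isUnit.mp fun c c' h => ?_
  have h0 : gramMat A *ᵥ (c - c') = 0 := by
    rw [Matrix.mulVec_sub]
    exact sub_eq_zero.mpr h
  have h1 : (genMat A *ᵥ (c - c')) ⬝ᵥ (genMat A *ᵥ (c - c')) = 0 := by
    rw [← dotProduct_gramMat_mulVec, h0, dotProduct_zero]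
  have h2 : genMat A *ᵥ (c - c') = 0 := dotProduct_self_eq_zero.mp h1
  have h3 : c - c' = 0 := mulVec_genMat_injective A (by rw [h2, Matrix.mulVec_zero])
  exact sub_eq_zero.mp h3

/-- The rational left inverse `R = (MᵀM)⁻¹ Mᵀ`. [cite: GreenTao2010, §4 (derivation of Thm. 1.8)] -/
def leftInv (A : Matrix (Fin s) (Fin t) ℤ) : Matrix (Fin (kerDim A)) (Fin t) ℚ :=
  (gramMat A)⁻¹ * (genMat A)ᵀ

/-- `RM = 1`. [cite: GreenTao2010, §4 (derivation of Thm. 1.8)] -/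
theorem leftInv_mul_genMat (A : Matrix (Fin s) (Fin t) ℤ) : leftInv A * genMat A = 1 := by
  rw [leftInv, Matrix.mul_assoc]
  exact Matrix.nonsing_inv_mul _ ((Matrix.isUnit_iff_isUnit_det _).mp (isUnit_gramMat A))

/-! ### Over `ℝ` -/

/-- The generator matrix over `ℝ`. [cite: GreenTao2010, §4 (derivation of Thm. 1.8)] -/
def realGenMat (A : Matrix (Fin s) (Fin t) ℤ) : Matrix (Fin t) (Fin (kerDim A)) ℝ :=
  fun i k => (kerGen A k i : ℝ)

/-- [cite: GreenTao2010, §4 (derivation of Thm. 1.8)] -/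
theorem realGenMat_eq_map (A : Matrix (Fin s) (Fin t) ℤ) :
    realGenMat A = (genMat A).map (Rat.castHom ℝ) := by
  funext i k
  simp [realGenMat, genMat, Matrix.map_apply]

/-- `(M_ℝ c)ᵢ = ∑ⱼ (vⱼ)ᵢ cⱼ`. [cite: GreenTao2010, §4 (derivation of Thm. 1.8)] -/
theorem realGenMat_mulVec (A : Matrix (Fin s) (Fin t) ℤ) (c : Fin (kerDim A) → ℝ) (i : Fin t) :
    (realGenMat A *ᵥ c) i = ∑ j, (kerGen A j i : ℝ) * c j := rfl

/-- The left inverse over `ℝ`. [cite: GreenTao2010, §4 (derivation of Thm. 1.8)] -/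
def realLeftInv (A : Matrix (Fin s) (Fin t) ℤ) : Matrix (Fin (kerDim A)) (Fin t) ℝ :=
  (leftInv A).map (Rat.castHom ℝ)

/-- `R_ℝ M_ℝ = 1`. [cite: GreenTao2010, §4 (derivation of Thm. 1.8)] -/
theorem realLeftInv_mul_realGenMat (A : Matrix (Fin s) (Fin t) ℤ) :
    realLeftInv A * realGenMat A = 1 := by
  rw [realGenMat_eq_map, realLeftInv, ← Matrix.map_mul, leftInv_mul_genMat]
  exact Matrix.map_one _ (map_zero _) (map_one _)

/-- **Coordinates are controlled by the image**: `|cⱼ| ≤ C'(A) · T` whenever `|(M_ℝ c)ᵢ| ≤ T`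
for all `i` (`T ≥ 0`). [cite: GreenTao2010, §4 (derivation of Thm. 1.8)] -/
theorem exists_coord_bound (A : Matrix (Fin s) (Fin t) ℤ) : ∃ C' : ℝ, 0 ≤ C' ∧
    ∀ (c : Fin (kerDim A) → ℝ) (T : ℝ), 0 ≤ T → (∀ i, |∑ j, (kerGen A j i : ℝ) * c j| ≤ T) →
      ∀ j, |c j| ≤ C' * T := by
  refine ⟨∑ j, ∑ i, |realLeftInv A j i|,
    Finset.sum_nonneg fun _ _ => Finset.sum_nonneg fun _ _ => abs_nonneg _, fun c T hT0 hT j => ?_⟩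
  have hc : c = realLeftInv A *ᵥ (realGenMat A *ᵥ c) := by
    rw [Matrix.mulVec_mulVec, realLeftInv_mul_realGenMat, Matrix.one_mulVec]
  calc |c j| = |∑ i, realLeftInv A j i * (realGenMat A *ᵥ c) i| := by
        conv_lhs => rw [hc]
        rfl
    _ ≤ ∑ i, |realLeftInv A j i * (realGenMat A *ᵥ c) i| := Finset.abs_sum_le_sum_abs _ _
    _ ≤ ∑ i, |realLeftInv A j i| * T := by
        refine Finset.sum_le_sum fun i _ => ?_
        rw [abs_mul]
        exact mul_le_mul_of_nonneg_left (by rw [realGenMat_mulVec]; exact hT i) (abs_nonneg _)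
    _ = (∑ i, |realLeftInv A j i|) * T := by rw [Finset.sum_mul]
    _ ≤ (∑ j, ∑ i, |realLeftInv A j i|) * T :=
        mul_le_mul_of_nonneg_right
          (Finset.single_le_sum (f := fun j => ∑ i, |realLeftInv A j i|)
            (fun _ _ => Finset.sum_nonneg fun _ _ => abs_nonneg _) (Finset.mem_univ j)) hT0

/-- **`K' ⊆ [−N', N']^{t−s}` with `N' = O_A(N + |x₀|)`**: if `Ψ_ℝ(c)` lies in the box
`[−N, N]^t` then every coordinate of `c` is at most `C'(A)(N + X)` where `|x₀ᵢ| ≤ X`.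
[cite: GreenTao2010, §4 (derivation of Thm. 1.8)] -/
theorem exists_preimage_box_bound (A : Matrix (Fin s) (Fin t) ℤ) : ∃ C' : ℝ, 0 ≤ C' ∧
    ∀ (x₀ : Fin t → ℤ) (c : Fin (kerDim A) → ℝ) (N X : ℝ), 0 ≤ N → 0 ≤ X →
      (∀ i, |(paramSystem A x₀ i).realEval c| ≤ N) → (∀ i, |(x₀ i : ℝ)| ≤ X) →
      ∀ j, |c j| ≤ C' * (N + X) := by
  obtain ⟨C', hC', h⟩ := exists_coord_bound A
  refine ⟨C', hC', fun x₀ c N X hN hX hc hx j => h c (N + X) (add_nonneg hN hX) (fun i => ?_) j⟩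
  have h1 := hc i
  rw [realEval_paramSystem] at h1
  have h2 := hx i
  calc |∑ j, (kerGen A j i : ℝ) * c j|
      = |(∑ j, (kerGen A j i : ℝ) * c j + (x₀ i : ℝ)) - (x₀ i : ℝ)| := by rw [add_sub_cancel_right]
    _ ≤ |∑ j, (kerGen A j i : ℝ) * c j + (x₀ i : ℝ)| + |(x₀ i : ℝ)| := abs_sub _ _
    _ ≤ N + X := add_le_add h1 h2

end Literature.NumberTheory.Sieve

end
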